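import Summits.BirchSwinnertonDyer.Rank1Residual.GaloisImage.KuriharaLowerBoundAssembly
import Summits.BirchSwinnertonDyer.Rank1Residual.GaloisImage.KatoKuriharaPortThreeWith
import HarnessLib

/-!
# P-KEYED twin of `KuriharaLowerBoundAssembly` — the two-level dictionary hypothesis `hdict` AT ONE PARAMETRISATION DATUM `P`
# (cell `b2b-bsdres`, team n1011; T-PORT-FIX (lead R5-112 (a) / R5-113 (a), joint text (ii-b)): the repaired
# port PORT″ `KatoKuriharaPortThreeAtWith₂ W t v₃ η P` unpacks to `KatoKuriharaDictionaryThreeAt₂At … P`, so the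
# lower-bound chain below the record corollary is re-keyed by ONE binder; seat p03 GEN 13 — BANKED bytes
# offered to the T-PORT-FIX owner n1011-p18, filed only on the owner's / lead's word)

HONEST FRAMING (cell `b2b-bsdres`, run/shared/lean/b2b/bsd-rank1-residual/, verbatim in every
file): the goal of the cell is to DELETE the COMBINATION-SHAPED residual classes of the
Birch–Swinnerton-Dyer formula for ALL analytic-rank `≤ 1` elliptic curves over `ℚ` — "full BSD
formula for every rank `≤ 1` curve in class `C`" assembled STRICTLY from published theorems — so
that the rank-`≤ 1` remainder becomes exactly the CONSTRUCTION-SHAPED classes, which are TYPED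
(missing-input `Prop`s), NOT attempted. This is not "finishing BSD". Team n1011 (N10/N11, the
additive block `X4 ∧ p = 3`): research route; no claim beyond the stated classes; the label X4 and
the mark of RESIDUAL-MAP §I N11 are UNCHANGED by this file; nothing is booked.  TOOL theorems only
(no definition, no named fact); CONDITIONAL exactly as `KuriharaLowerBoundAssembly.lean` EXCEPT that the two-level
dictionary hypothesis is the `P`-keyed `KatoKuriharaDictionaryThreeAt₂At W t k k′ D D′ red v₃ P`
(n1011-p18's PORT″ append to `GaloisImage/KatoKuriharaPortThreeWith.lean`, joint text of lead R5-112 (a)):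
binder diff EXACTLY {{`hdict : … KatoKuriharaDictionaryThreeAt₂ … v₃`}} ↦
{{`hdict : … KatoKuriharaDictionaryThreeAt₂At … v₃ P`}} at the theorem's own `P` (which already precedes
`hdict` in the signature); the ONE application `hdict … hv₃ P hcP hper` loses its `P`; every call into the
chain is re-pointed to the `_at` twin below; every other token is the original.  WHY: the universal-closure
PORT was shown UNSATISFIABLE on its population (n1011-p11 GEN 11, T-PORT-NEG p326481; r1 GEN 47 / referee-1
GEN 48 CONFIRMED); the repair displays ONE generator family `η` AND keys the dictionary at the record's own
parametrisation datum `P` so that its NAMED DISCHARGER (★ PK-6₂) reaches it with no lemma the tree lacks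
(DESIGN CRITERION OF RECORD, R5-112 (a)).  The original `∀ P` theorems stay (parents: `….at P`).

References: as `KuriharaLowerBoundAssembly.lean`; cells/n1011/PLAN.md R5-110 / R5-112 / R5-113; ROUTE-1.md §59–§60.
-/

noncomputable section

open scoped Classical NumberField ContRepresentation
open Function NumberField IsDedekindDomain WeierstrassCurve
  Literature.NumberTheory.EllipticCurves Literature.NumberTheory.EllipticCurves.ModularForms
  Literature.NumberTheory.EllipticCurves.Rank1Residual
  Literature.NumberTheory.GaloisRepresentations
  Literature.NumberTheory.GaloisRepresentations.DiscreteGaloisModule Literature.NumberTheory.GaloisCohomology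

namespace Summit.BirchSwinnertonDyer.Rank1Residual.GaloisImage.Assembly

/-- **P-KEYED twin of `pow_dvd_natCard_selmerGroup_of_certificate` (T-PORT-FIX, joint text (ii-b) of lead R5-112 (a) / R5-113 (a)):** binder diff EXACTLY {`hdict : … KatoKuriharaDictionaryThreeAt₂ … v₃`} ↦ {`hdict : … KatoKuriharaDictionaryThreeAt₂At … v₃ P`} at this theorem's own `P`; conclusion and every other binder identical; the original docstring follows verbatim.
**(a′) assembled at `p = 3`, datum currency.**  Row: `W` globally minimal, additive at `3`,
`3 ∤ c₃`, `ρ̄₃` onto, `#E(ℚ₃)[3] = 3^t`, `v₃ ∣ 3`, Manin datum `P` with `3 ∤ c_P` and the period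
transfer.  Levels `k ≤ k′`, data `D` (depth `k`) and `D′` (depth `k′`), the reduction `red` pinned on
points.  INPUTS AS HYPOTHESES: the two-level dictionary `hdict` (p09, PORT); generators `g`, `g′` of
the two Kolyvagin-system groups with every system a natural multiple (Sakamoto Thm. 4.4 (1), p13's
instances); Thm. 4.4 (2) at `(k′, ∅)` in ORDER form for `g′` w.r.t. the dual Selmer group of the PT
family `inv′` (R1-22); the scalar TRANSPORT `htr` (p11); the PT family `inv′` at modulus `3^{k′+1}`
with its four properties + injectivity, `hEP`, an admissible `T ∋ v₃`; the certificate at a level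
`n` of `D`: `δ̃^{(j)}_n(ψ₀) ≠ 0`, `t + j ≤ k + 1`, the vanishing of the proper sub-level numbers mod
`3^j` (hypothesis (v), `∅` included: `v ≥ j`), `3`-integrality of the symbols; the `L`-value
visibility `δ̃_1 = [0]⁺ ≡ 3^v · unit (mod 3^{k′+1})`; the exponent `3^X` of `Sel_{3^{k′+1}}` and the
DEPTH `X + t + v < k′ + 1`.  OUTPUT: `3^{v+1−j} ∣ #Sel_{3^{k′+1}}(E/ℚ)`.  (B6): on `t = 1` rows
supply `D ⊆ 𝒫_{k+1+t}`, `D′ ⊆ 𝒫_{k′+1+t}` (the [S24]-side inputs are then S24-DEEP, R1-35).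
[cite: Kim2022StructureSelmer, Thm. 1.9 (6) and Thm. 3.13] [cite: Sakamoto2024, Thm. 4.4 (p. 926)]
[cite: MazurRubin2004, Thm. 3.2.4 and App. A (33)] -/
theorem pow_dvd_natCard_selmerGroup_of_certificate_at
    (W : WeierstrassCurve ℚ) [W.IsElliptic] [W.IsGloballyMinimal] (t k k' : ℕ) (hkk' : k ≤ k')
    (D : KolyvaginDatum (W.torsionGaloisModule (((3 : ℕ) : ℤ) ^ k * ((3 : ℕ) : ℤ))))
    (D' : KolyvaginDatum (W.torsionGaloisModule (((3 : ℕ) : ℤ) ^ k' * ((3 : ℕ) : ℤ))))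
    (red : (W.torsionGaloisModule (((3 : ℕ) : ℤ) ^ k' * ((3 : ℕ) : ℤ))).toContRepresentation →ⁱL
      (W.torsionGaloisModule (((3 : ℕ) : ℤ) ^ k * ((3 : ℕ) : ℤ))).toContRepresentation)
    (hred : ∀ x : geomTorsion W (((3 : ℕ) : ℤ) ^ k' * ((3 : ℕ) : ℤ)),
      ((red x : geomTorsion W (((3 : ℕ) : ℤ) ^ k * ((3 : ℕ) : ℤ))) : geomPoints W) =
        (((3 : ℕ) : ℤ) ^ (k' - k)) • (x : geomPoints W))
    (v₃ : HeightOneSpectrum (𝓞 ℚ)) (hv₃ : ((3 : ℕ) : 𝓞 ℚ) ∈ v₃.asIdeal)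
    -- the row
    (hadd : Addv W 3) (hc3 : ¬ 3 ∣ (W.baseChange ℚ_[3]).localTamagawaNumber ℤ_[3])
    (hsurj : W.HasSurjectiveModNGaloisRep ((3 : ℕ) : ℤ))
    (ht : Nat.card {Q : (W.baseChange ℚ_[3]).toAffine.Point // (3 : ℕ) • Q = 0} = 3 ^ t)
    {N : ℕ} [NeZero N] (P : ModularParametrizationData W N) (hcP : ¬ ((3 : ℕ) : ℤ) ∣ P.maninConstant)
    (hper : ∃ u : ℚ, ‖(u : ℚ_[3])‖ = 1 ∧ W.realPeriodRat = u * plusPeriod P.f)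
    -- the two-level dictionary (PORT)
    (hdict : KatoKuriharaDictionaryThreeAt₂At W t k k' D D' red v₃ P)
    -- generators of `KS₁` at the two levels
    (g : Finset (HeightOneSpectrum (𝓞 ℚ)) →
      galoisCohomology (W.torsionGaloisModule (((3 : ℕ) : ℤ) ^ k * ((3 : ℕ) : ℤ))) 1)
    (hgen : ∀ κ ∈ D.kolyvaginSystems (propagatedSelmerStructure W 3 k), ∃ a : ℕ, κ = a • g)
    (g' : Finset (HeightOneSpectrum (𝓞 ℚ)) →
      galoisCohomology (W.torsionGaloisModule (((3 : ℕ) : ℤ) ^ k' * ((3 : ℕ) : ℤ))) 1)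
    (hg' : g' ∈ D'.kolyvaginSystems (propagatedSelmerStructure W 3 k'))
    (hgen' : ∀ κ ∈ D'.kolyvaginSystems (propagatedSelmerStructure W 3 k'), ∃ a : ℕ, κ = a • g')
    -- the Poitou–Tate family at the deep modulus, `hEP`, an admissible `T`
    (inv' : LocalInvariants ℚ (3 ^ (k' + 1))) (hperf' : inv'.IsPerfect)
    (hsum' : inv'.SumLocalTermEqZero) (hcompl' : inv'.SelmerComplement)
    (hinj' : ∀ v : HeightOneSpectrum (𝓞 ℚ), Injective (inv' (Sum.inr v)))
    (hEP : ∀ v : HeightOneSpectrum (𝓞 ℚ), localEulerPoincareCharacteristic (v.adicCompletion ℚ))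
    (T : Finset (HeightOneSpectrum (𝓞 ℚ))) (hv₃T : v₃ ∈ T)
    (hT : ∀ v : HeightOneSpectrum (𝓞 ℚ), v ∉ T →
      (((3 ^ (k' + 1) : ℕ) : ℕ) : 𝓞 ℚ) ∉ v.asIdeal ∧
        GaloisRep.IsUnramifiedAt v (W.torsionGaloisModule (((3 : ℕ) : ℤ) ^ k' * ((3 : ℕ) : ℤ))))
    (h𝓕T : (propagatedSelmerStructure W 3 k').IsUnramifiedOutside (finSupport T))
    (h𝓚T : (W.kummerSelmerStructure (((3 : ℕ) : ℤ) ^ k' * ((3 : ℕ) : ℤ))).IsUnramifiedOutside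
      (finSupport T))
    [Finite (geomTorsion W (((3 : ℕ) : ℤ) ^ k' * ((3 : ℕ) : ℤ)))]
    [Finite (W.kummerSelmerStructure (((3 : ℕ) : ℤ) ^ k' * ((3 : ℕ) : ℤ))).selmerGroup]
    -- Thm. 4.4 (2) at `(k′, ∅)` in ORDER form for `g′`
    (hR22 : (Nat.card (inv'.dualSelmerStructure (W.torsionGaloisModule (((3 : ℕ) : ℤ) ^ k' * ((3 : ℕ) : ℤ)))
          (propagatedSelmerStructure W 3 k')).selmerGroup ∣ 3 ^ (k' + 1) →
        addOrderOf (g' ∅) * Nat.card (inv'.dualSelmerStructure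
          (W.torsionGaloisModule (((3 : ℕ) : ℤ) ^ k' * ((3 : ℕ) : ℤ)))
            (propagatedSelmerStructure W 3 k')).selmerGroup = 3 ^ (k' + 1)) ∧
      (3 ^ (k' + 1) ∣ Nat.card (inv'.dualSelmerStructure
          (W.torsionGaloisModule (((3 : ℕ) : ℤ) ^ k' * ((3 : ℕ) : ℤ)))
            (propagatedSelmerStructure W 3 k')).selmerGroup → g' ∅ = 0))
    (hNp : ∃ l, Nat.card (inv'.dualSelmerStructure
        (W.torsionGaloisModule (((3 : ℕ) : ℤ) ^ k' * ((3 : ℕ) : ℤ)))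
          (propagatedSelmerStructure W 3 k')).selmerGroup = 3 ^ l)
    -- the scalar transport through a common core vertex (p11)
    (htr : ∀ (κ' : Finset (HeightOneSpectrum (𝓞 ℚ)) →
        galoisCohomology (W.torsionGaloisModule (((3 : ℕ) : ℤ) ^ k * ((3 : ℕ) : ℤ))) 1)
      (κu' : Finset (HeightOneSpectrum (𝓞 ℚ)) →
        galoisCohomology (W.torsionGaloisModule (((3 : ℕ) : ℤ) ^ k' * ((3 : ℕ) : ℤ))) 1)
      (a a' : ℕ), κ' ∈ D.kolyvaginSystems (propagatedSelmerStructure W 3 k) →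
        κu' ∈ D'.kolyvaginSystems (propagatedSelmerStructure W 3 k') →
        κ' = a • g → κu' = a' • g' →
        (∀ d, D'.IsLevel d → D.IsLevel d → galoisCohomology.map red 1 (κu' d) = κ' d) →
        ∀ s, s ≤ k + 1 → (3 ^ s ∣ a ↔ 3 ^ s ∣ a'))
    -- the certificate at a level `n` of `D`
    (n : Finset (HeightOneSpectrum (𝓞 ℚ))) (hn : D.IsLevel n) {j : ℕ} (htj : t + j ≤ k + 1)
    (hden : ∀ d ⊆ n, ∀ a : ℕ,
      (ratPlusSymbol P.f ((a : ℚ) / (∏ q ∈ d, Ideal.absNorm q.asIdeal : ℕ))).den.Coprime (3 ^ (k + 1)))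
    {ψ₀ : (ℓ : ℕ) → (ZMod ℓ)ˣ →* Multiplicative (ZMod (3 ^ j))}
    (hψ₀ : ∀ q ∈ n, Function.Surjective (ψ₀ (Ideal.absNorm q.asIdeal)))
    (hcert : haveI : NeZero (∏ q ∈ n, Ideal.absNorm q.asIdeal) :=
        ⟨Finset.prod_ne_zero_iff.2 fun q _ => absNorm_ne_zero q⟩
      kuriharaNumber P.f (3 ^ j) (∏ q ∈ n, Ideal.absNorm q.asIdeal) ψ₀ ≠ 0)
    (hv : ∀ c, c ⊂ n → ∀ ψ' : (ℓ : ℕ) → (ZMod ℓ)ˣ →* Multiplicative (ZMod (3 ^ j)),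
      (∀ q ∈ c, Function.Surjective (ψ' (Ideal.absNorm q.asIdeal))) →
        haveI : NeZero (∏ q ∈ c, Ideal.absNorm q.asIdeal) :=
          ⟨Finset.prod_ne_zero_iff.2 fun q _ => absNorm_ne_zero q⟩
        kuriharaNumber P.f (3 ^ j) (∏ q ∈ c, Ideal.absNorm q.asIdeal) ψ' = 0)
    -- the `L`-value at the deep modulus
    {v : ℕ} (hLval : ∃ w₀ : (ZMod (3 ^ (k' + 1)))ˣ, ∀ ψ : (ℓ : ℕ) → (ZMod ℓ)ˣ →* Multiplicative (ZMod (3 ^ (k' + 1))),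
      kuriharaNumber P.f (3 ^ (k' + 1)) 1 ψ = ((3 ^ v : ℕ) : ZMod (3 ^ (k' + 1))) * (w₀ : ZMod _))
    -- exponent of the deep Selmer group, and the depth
    {X : ℕ} (hX : ∀ s ∈ (W.kummerSelmerStructure (((3 : ℕ) : ℤ) ^ k' * ((3 : ℕ) : ℤ))).selmerGroup,
      3 ^ X • s = 0)
    (hK : X + t + v < k' + 1) :
    3 ^ (v + 1 - j) ∣
      Nat.card (W.kummerSelmerStructure (((3 : ℕ) : ℤ) ^ k' * ((3 : ℕ) : ℤ))).selmerGroup := by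
  haveI : Fact (Nat.Prime 3) := ⟨Nat.prime_three⟩
  -- unpack the two-level dictionary
  obtain ⟨κ, Λ, κ', κu, Λu, κu', hWk, hWk', hcomp⟩ :=
    hdict hkk' hred hadd hc3 hsurj ht hv₃ hcP hper
  obtain ⟨-, ⟨hKS, hbr⟩, -, -, hdictk⟩ := hWk
  obtain ⟨-, ⟨hKS', hbr'⟩, hon', hker', hdictk'⟩ := hWk'
  -- Kato's systems on the generators
  obtain ⟨a, ha⟩ := hgen κ' hKS
  obtain ⟨a', ha'⟩ := hgen' κu' hKS'
  -- the transport
  have htr' := htr κ' κu' a a' hKS hKS' ha ha' (fun d hd' hd => (hcomp d hd' hd).2) (t + j) htj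
  -- SHALLOW: `3^{t+j} ∤ a`
  have hshallow : ¬ 3 ^ (t + j) ∣ a := by
    refine (Shallow.not_pow_dvd_of_certificate_levelwise (p := 3) P.f
      (Λ.comp (galoisCohomology.localization _ (Sum.inr v₃) 1)) κ κ'
      (fun q : HeightOneSpectrum (𝓞 ℚ) => Ideal.absNorm q.asIdeal) n absNorm_ne_zero
      (fun q _ => FSComp.prime_absNorm_rat q) (absNorm_injOn _) hden ?_ (hbr n hn) (g := g n)
      (a := a) (by rw [ha]; rfl) htj hψ₀ hcert hv).2
    intro d hd
    have hdl : D.IsLevel d := fun q hq => hn (hd hq)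
    obtain ⟨u, ψ, hψ, hL⟩ := hdictk d hdl
    exact ⟨u, ψ, hψ, by simpa [AddMonoidHom.comp_apply] using hL⟩
  have hcert' : ¬ 3 ^ (t + j) ∣ a' := fun h => hshallow (htr'.2 h)
  -- DEEP
  obtain ⟨w₀, hw₀⟩ := hLval
  obtain ⟨u0, ψ0, -, hL0⟩ := hdictk' ∅ D'.isLevel_empty
  have hbr₀ : κu' ∅ = κu ∅ := by
    have h := hbr' ∅ D'.isLevel_empty
    have hbot : AddSubgroup.closure
        {x : galoisCohomology (W.torsionGaloisModule (((3 : ℕ) : ℤ) ^ k' * ((3 : ℕ) : ℤ))) 1 |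
          ∃ c, c ⊂ (∅ : Finset (HeightOneSpectrum (𝓞 ℚ))) ∧ x = κu c} = ⊥ := by
      rw [AddSubgroup.closure_eq_bot_iff]
      rintro x ⟨c, hc, -⟩
      exact absurd hc (Finset.not_ssubset_empty c)
    rw [hbot, AddSubgroup.mem_bot, sub_eq_zero] at h
    exact h
  have htv : t + v < k' + 1 := by omega
  have hcount := DeepLedger.natCard_selmerGroup_propagated_eq W 3 k' (by norm_num) hv₃ Λu hon' hker'
    inv' hperf' hsum' hcompl' hinj' hEP T hv₃T hT h𝓕T h𝓚T
  refine DeepLedger.pow_dvd_natCard_selmerGroup_of_deep W 3 k' (by norm_num) hv₃ Λu hker' hbr₀ htv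
    u0 w₀ (hw₀ ψ0) ?_ (KolyvaginDatum.IsKolyvaginSystem.apply_empty_mem hg') (a' := a') (by rw [ha']; rfl)
    hNp hR22 hcount hcert' hX hK.le
  -- the empty-level dictionary value: `∏_{q ∈ ∅} Nq = 1`
  simpa using hL0

end Summit.BirchSwinnertonDyer.Rank1Residual.GaloisImage.Assembly

end
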